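import Summits.HodgeConjecture.HodgeConjecture.Theorems.Ring2ClassTargets
import Literature.AlgebraicGeometry.HodgeTheory.AbelianLowDimensionCodimTwoHodgeClasses
import Literature.AlgebraicGeometry.HodgeTheory.WeilClassesFourfolds
import Literature.AlgebraicGeometry.HodgeTheory.HardLefschetzNFoldHolds
import Literature.AlgebraicGeometry.HodgeTheory.LefschetzOneOneHolds
import Literature.AlgebraicGeometry.HodgeTheory.ComplexConjugationHolds
import HarnessLib

/-!
# Ring 2 around `HC_CM` — the atlas ROWS `g ≤ 7` in the kernel: which rows have cells of their own (typer 1)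

HONEST FRAMING (page 1, verbatim in every file of this cell): research route conditional on HC_CM; not a
corollary; Q11.4-sentence-2 already refuted in dim ≥ 3.

`HC_CM` := `Theses.RankFourFaces.CMAbelianHodge` (item stmt-HodgeConjecture-3052) is OPEN and occurs below only
as a HYPOTHESIS, by name (§R4); `HC_AV` := `Theses.PadicSemiregularLift.HodgeAbelianVarieties` (stmt-1333) and
`CMToAbelian` (stmt-16267) are OPEN route items, by name. Nothing here decides any of them. The three
CLASSIFICATION inputs are REFEREED named facts of the tree taken as hypotheses, never asserted:
`MoonenZarhin1999_codimTwoHodgeClasses_abelianFourfold` (Math. Ann. 315 (1999) Thm. 0.1, codimension 2 on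
fourfolds), `MoonenZarhin1999_codimTwoHodgeClasses_abelianFivefold` (Thm. 0.2, codimension 2 on fivefolds),
`TankeevRibet1983_hodgeClasses_divisorial_powers_simplePrimeDimension` (simple, prime dimension). The one CELL
is the typed statement `Markman2025_weilClasses_algebraic_abelianFourfold` (rational `(2,2)` Weil classes of
every `(A, φ, d)`, `dim A = 4`, `φ² = -d`; in print: `det H = 1` and the general member for `ℚ(√-3)` (Schoen 1988;
van Geemen 1994 §7.1–7.2) and for `ℚ(i)` (van Geemen 1994 §7.4, Math. Z. 1996), Markman 2023 (JEMS 25) for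
discriminant `1` — refereed; arXiv:2502.03415 Cor. 1.6.1 in general — UNREFEREED), used as a hypothesis or a
conclusion, never asserted. No new named fact, no `sorry`, no new
definition.

WHAT THIS FILE PROVES (sequel to `Theorems/Ring2ClassTargets.lean`, same namespace; answers RING2-MAP `## §LEAD
(gen 3)` L3.7 (iii) "row g is reduced to cells c₁ … c_k is a KERNEL statement, not prose"):
* §R1 ROW `4` IS ONE CELL: `HCUpToDim 4 ↔ Markman2025_weilClasses_algebraic_abelianFourfold` modulo MZ Thm. 0.1
  (`hcUpToDim_four_iff_weilClassesFourfolds`); the direction `→` is unconditional (on-path,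
  `weilClassesFourfolds_of_hcAtDim_four`). Lefschetz `(1,1)`, hard Lefschetz, Hodge models and `D² ⊆ N²` are tree
  THEOREMS (`lefschetzOneOne_rational_holds`, `nonempty_hardLefschetzNFold_holds`, `nonempty_hodgeModel_holds`,
  `AbelianVariety.divisorClassesSpan_le_algebraicClasses`), so nothing but Thm. 0.1 and the cell is consumed.
* §R2 ROW `5` HAS NO CELL: `HCUpToDim 5 ↔ HCUpToDim 4` modulo MZ Thm. 0.2 (`hcUpToDim_five_iff_hcUpToDim_four`:
  the codimension-2 classes of a fivefold are divisor monomials plus pull-backs of `B²` of fourfold quotients);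
  hence `HCUpToDim 5 ↔` the cell, and the route item `Theses.SevenfoldWeilCensus.HodgeAbelianDimLeFive`
  (stmt-18723) is EXACTLY the cell modulo Thms. 0.1–0.2 (`hodgeAbelianDimLeFive_iff_weilClassesFourfolds`).
* §R3 THE `g ≤ 7` TARGET RE-ASSEMBLED: `HCUpToDim 7 ↔ cell ∧ HCAtDim 6 ∧ HC(non-simple sevenfolds)` and
  `HC_AV ↔ cell ∧ HCAtDim 6 ∧ HC(non-simple sevenfolds) ∧ HodgeAbelianDimGeEight`, modulo the three facts — so of
  the atlas rows `g ≤ 7` exactly `g = 4` (one cell), `g = 6` and the non-simple part of `g = 7` carry open content.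
* §R4 UNDER `HC_CM`: what item 16267 delivers on these rows and, conversely, that the four conjuncts give
  `CMToAbelian` without using `HC_CM` — on rows `g ≤ 5` the conditional hypothesis is NOT load-bearing.

References (bib keys): MoonenZarhin1999LowDim (Thms. 0.1, 0.2, (1.9), (2.7), (2.8), §5 (5.11); arXiv:math/9901113),
Markman2025SecantWeil = arXiv:2502.03415 (Cor. 1.6.1, UNREFEREED), Markman2025SurveySecant = arXiv:2509.23403
(Cor. 1.3, UNREFEREED), Schoen1988HodgeWeil, vanGeemen1994HodgeAV (§7, Thm. 4.6, Lemma 3.7), Tankeev1983,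
Ribet1983, VoisinHodgeI2002 (Thm. 6.25, Thm. 11.30), Fulton1998 (§19.2), Deligne2000 (§1), Milne1999 (§7 (H)).
-/

set_option linter.dupNamespace false

noncomputable section

open CategoryTheory
open Literature.AlgebraicGeometry Literature.AlgebraicGeometry.Motives
open Literature.AlgebraicGeometry.HodgeTheory
open Literature.AlgebraicGeometry.Milne1999

namespace Summit.HodgeConjecture.HodgeConjecture.Ring2.ClassTargets

open Literature.Barriers.HodgeConjecture

/-! ## §R1 Row `g = 4` is EXACTLY the Weil-fourfold cell, modulo Moonen–Zarhin Thm. 0.1 -/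

/-- **ON-PATH for the Weil-fourfold cell**: HC for abelian fourfolds gives the algebraicity of the rational
`(2,2)` Weil classes of every `(A, φ, d)` with `dim A = 4`, `φ ≫ φ = -d` — the typed cell
`Markman2025_weilClasses_algebraic_abelianFourfold` (arXiv:2502.03415 Cor. 1.6.1, UNREFEREED in general) is a
CONSEQUENCE of row `4`; no input. [cite: Deligne2000, §1] [cite: Markman2025SecantWeil, Cor. 1.6.1] -/
theorem weilClassesFourfolds_of_hcAtDim_four (h : HCAtDim 4) :
    Markman2025_weilClasses_algebraic_abelianFourfold := by
  intro d _ A φ hA _ _ c hc h22 _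
  have h4 : HodgeConjectureFor A.dim A.X := h A (by omega)
  rw [hA] at h4
  exact h4.2 2 c hc h22

/-- The same consequence read from `HC_AV`. [cite: Deligne2000, §1] -/
theorem weilClassesFourfolds_of_hodgeAbelianVarieties (h : Theses.PadicSemiregularLift.HodgeAbelianVarieties) :
    Markman2025_weilClasses_algebraic_abelianFourfold :=
  weilClassesFourfolds_of_hcAtDim_four fun A _ ↦ h A

/-- **Row `4` from the Weil-fourfold cell, modulo Moonen–Zarhin 1999 Thm. 0.1 (refereed, as the hypothesis
`MoonenZarhin1999_codimTwoHodgeClasses_abelianFourfold`), NO `HC_CM`.** On a complex abelian fourfold: codimension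
`0` is trivial, codimension `1` is Lefschetz `(1,1)` (tree theorem `lefschetzOneOne_rational_holds`), codimension `2`
is `B² ⊆ D² + Σ_k W_k` (Thm. 0.1) with `D²` algebraic (`AbelianVariety.divisorClassesSpan_le_algebraicClasses`) and
the Weil summands algebraic by the cell (`mem_algebraicClasses_two_of_dim_eq_four`), codimensions `3, 4` follow
from `1, 0` by hard Lefschetz (tree theorem `nonempty_hardLefschetzNFold_holds`). Hodge models exist
(`nonempty_hodgeModel_holds`). [cite: MoonenZarhin1999LowDim, Thm. 0.1 with (1.4), (1.9); arXiv:math/9901113]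
[cite: VoisinHodgeI2002, Thm. 6.25 and Thm. 11.30] [cite: Markman2025SecantWeil, Cor. 1.6.1] -/
theorem hcAtDim_four_of_weilClassesFourfolds (h01 : MoonenZarhin1999_codimTwoHodgeClasses_abelianFourfold)
    (hW : Markman2025_weilClasses_algebraic_abelianFourfold) : HCAtDim 4 := by
  intro A hA
  have hX : IsSmoothProjective A.dim A.X := AbelianVariety.isSmoothProjective_holds
  have h11 : ∀ b : complexBetti A.X (2 * 1), IsRationalClass b → IsOfHodgeType A.dim A.X (2 * 1) 1 1 b →
      b ∈ algebraicClasses A.X 1 := fun b hb hbb ↦ lefschetzOneOne_rational_holds hX b hb hbb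
  refine ⟨nonempty_hodgeModel_holds hX, fun p c hc hpp ↦ ?_⟩
  have low : ∀ (q : ℕ) (c : complexBetti A.X (2 * q)), 2 * q ≤ A.dim → IsRationalClass c →
      IsOfHodgeType A.dim A.X (2 * q) q q c → c ∈ algebraicClasses A.X q := by
    intro q c hq hc hqq
    have hq2 : q ≤ 2 := by omega
    interval_cases q
    · exact hodgeConjectureFor_codim_zero c
    · exact h11 c hc hqq
    · exact mem_algebraicClasses_two_of_dim_eq_four hW A hA h11 (h01 A hA c hc hqq)
  rcases Nat.lt_or_ge A.dim (2 * p) with hlt | hge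
  · exact mem_algebraicClasses_of_lt_of_nonempty (nonempty_hardLefschetzNFold_holds A.dim A.X) hX hlt
      (fun c' hc' hpp' ↦ low (A.dim - p) c' (by omega) hc' hpp') c hc hpp
  · exact low p c hge hc hpp

/-- **Row `4` (hence rows `g ≤ 4`) is EXACTLY the Weil-fourfold cell, modulo Moonen–Zarhin Thm. 0.1**:
`HCUpToDim 4 ↔ Markman2025_weilClasses_algebraic_abelianFourfold`. So the atlas row `g = 4` has ONE open cell
in the kernel — the rational `(2,2)` Weil classes of the fourfolds `(A, ℚ(√-d) ⊂ End⁰ A)`, all `d`, all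
discriminants — refereed for `det H = 1` and the general member when `K = ℚ(√-3)` (Schoen 1988; van Geemen 1994
§7.1–7.2) or `K = ℚ(i)` (van Geemen 1994 §7.4, Math. Z. 1996), for discriminant `1` (Markman 2023, JEMS 25); open
in print otherwise (arXiv:2502.03415 UNREFEREED). `HC_CM` is NOT an input of this row.
[cite: MoonenZarhin1999LowDim, Thm. 0.1; arXiv:math/9901113] [cite: Markman2025SecantWeil, Cor. 1.6.1]
[cite: Schoen1988HodgeWeil, Thm.] [cite: vanGeemen1994HodgeAV, §7.1–7.2 and §7.4] -/
theorem hcUpToDim_four_iff_weilClassesFourfolds (h01 : MoonenZarhin1999_codimTwoHodgeClasses_abelianFourfold) :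
    HCUpToDim 4 ↔ Markman2025_weilClasses_algebraic_abelianFourfold :=
  ⟨fun h ↦ weilClassesFourfolds_of_hcAtDim_four (hcAtDim_of_hcUpToDim h),
    fun hW ↦ hcUpToDim_of_hcAtDim (hcAtDim_four_of_weilClassesFourfolds h01 hW)⟩

/-! ## §R2 Row `g = 5` COLLAPSES onto row `4`, modulo Moonen–Zarhin Thm. 0.2 -/

/-- **Row `5` from row `4`, modulo Moonen–Zarhin 1999 Thm. 0.2 (refereed, as the hypothesis
`MoonenZarhin1999_codimTwoHodgeClasses_abelianFivefold`), NO `HC_CM`, NO Weil-class input.** On a complex abelian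
fivefold the codimension-`2` Hodge classes lie in `D² + Σ_α α^* B²(B)` over surjective homomorphisms onto abelian
FOURFOLDS `B` (Thm. 0.2); `B²(B)` is algebraic by row `4` and pull-back preserves algebraic classes
(`mem_algebraicClasses_two_of_dim_eq_five_of_fourfolds`); codimension `1` is Lefschetz `(1,1)`, codimensions
`3, 4, 5` follow by hard Lefschetz. The atlas row `g = 5` therefore has NO cell of its own in the kernel.
[cite: MoonenZarhin1999LowDim, Thm. 0.2 with (2.8), §5 (5.11); arXiv:math/9901113]
[cite: VoisinHodgeI2002, Thm. 6.25 and Thm. 11.30] [cite: Fulton1998, §19.2 Cor. 19.2 (b)] -/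
theorem hcAtDim_five_of_hcAtDim_four (h02 : MoonenZarhin1999_codimTwoHodgeClasses_abelianFivefold)
    (h4 : HCAtDim 4) : HCAtDim 5 := by
  intro A hA
  have hX : IsSmoothProjective A.dim A.X := AbelianVariety.isSmoothProjective_holds
  have h11 : ∀ b : complexBetti A.X (2 * 1), IsRationalClass b → IsOfHodgeType A.dim A.X (2 * 1) 1 1 b →
      b ∈ algebraicClasses A.X 1 := fun b hb hbb ↦ lefschetzOneOne_rational_holds hX b hb hbb
  have hB : ∀ B : AbelianVariety ℂ, B.dim = 4 → ∀ w : complexBetti B.X (2 * 2), IsRationalClass w →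
      IsOfHodgeType B.dim B.X (2 * 2) 2 2 w → w ∈ algebraicClasses B.X 2 :=
    fun B hB w hw hw22 ↦ (h4 B hB).2 2 w hw hw22
  refine ⟨nonempty_hodgeModel_holds hX, fun p c hc hpp ↦ ?_⟩
  have low : ∀ (q : ℕ) (c : complexBetti A.X (2 * q)), 2 * q ≤ A.dim → IsRationalClass c →
      IsOfHodgeType A.dim A.X (2 * q) q q c → c ∈ algebraicClasses A.X q := by
    intro q c hq hc hqq
    have hq2 : q ≤ 2 := by omega
    interval_cases q
    · exact hodgeConjectureFor_codim_zero c
    · exact h11 c hc hqq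
    · exact mem_algebraicClasses_two_of_dim_eq_five_of_fourfolds hB A h11 (h02 A hA c hc hqq)
  rcases Nat.lt_or_ge A.dim (2 * p) with hlt | hge
  · exact mem_algebraicClasses_of_lt_of_nonempty (nonempty_hardLefschetzNFold_holds A.dim A.X) hX hlt
      (fun c' hc' hpp' ↦ low (A.dim - p) c' (by omega) hc' hpp') c hc hpp
  · exact low p c hge hc hpp

/-- **`HCUpToDim 5 ↔ HCUpToDim 4` modulo Moonen–Zarhin Thm. 0.2.** [cite: MoonenZarhin1999LowDim, Thm. 0.2; arXiv:math/9901113] -/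
theorem hcUpToDim_five_iff_hcUpToDim_four (h02 : MoonenZarhin1999_codimTwoHodgeClasses_abelianFivefold) :
    HCUpToDim 5 ↔ HCUpToDim 4 :=
  ⟨hcUpToDim_mono (by norm_num),
    fun h4 ↦ (hcUpToDim_succ_iff 4).mpr ⟨h4, hcAtDim_five_of_hcAtDim_four h02 (hcAtDim_of_hcUpToDim h4)⟩⟩

/-- **Rows `g ≤ 5` are EXACTLY the Weil-fourfold cell, modulo the two refereed Moonen–Zarhin facts**:
`HCUpToDim 5 ↔ Markman2025_weilClasses_algebraic_abelianFourfold` (the converse of the frame's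
`hcUpToDim_five_of_codimTwoFacts_of_weilClassesFourfolds`). [cite: MoonenZarhin1999LowDim, Thms. 0.1, 0.2; arXiv:math/9901113]
[cite: Markman2025SecantWeil, Cor. 1.6.1] -/
theorem hcUpToDim_five_iff_weilClassesFourfolds (h01 : MoonenZarhin1999_codimTwoHodgeClasses_abelianFourfold)
    (h02 : MoonenZarhin1999_codimTwoHodgeClasses_abelianFivefold) :
    HCUpToDim 5 ↔ Markman2025_weilClasses_algebraic_abelianFourfold := by
  rw [hcUpToDim_five_iff_hcUpToDim_four h02, hcUpToDim_four_iff_weilClassesFourfolds h01]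

/-- **EXACTNESS of the route item `Theses.SevenfoldWeilCensus.HodgeAbelianDimLeFive`** (stmt-HodgeConjecture-18723,
by name): modulo Moonen–Zarhin Thms. 0.1–0.2 it is EQUIVALENT to the Weil-fourfold cell — the item is neither
weaker nor stronger than "Weil classes on Weil-type abelian fourfolds are algebraic".
[cite: MoonenZarhin1999LowDim, Thms. 0.1, 0.2; arXiv:math/9901113] [cite: Markman2025SecantWeil, Cor. 1.6.1] -/
theorem hodgeAbelianDimLeFive_iff_weilClassesFourfolds
    (h01 : MoonenZarhin1999_codimTwoHodgeClasses_abelianFourfold)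
    (h02 : MoonenZarhin1999_codimTwoHodgeClasses_abelianFivefold) :
    Theses.SevenfoldWeilCensus.HodgeAbelianDimLeFive ↔ Markman2025_weilClasses_algebraic_abelianFourfold := by
  rw [← hcUpToDim_five_iff_hodgeAbelianDimLeFive, hcUpToDim_five_iff_weilClassesFourfolds h01 h02]

/-! ## §R3 The `g ≤ 7` target re-assembled on the atlas axis -/

/-- **`HCUpToDim 7 ↔ HCUpToDim 4 ∧ HCAtDim 6 ∧ HC(non-simple sevenfolds)`, modulo Tankeev–Ribet and
Moonen–Zarhin Thm. 0.2** (both refereed, as hypotheses; NO `HC_CM`): of the atlas rows `g ≤ 7` only `g = 4` (one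
cell), `g = 6` and the NON-SIMPLE sevenfolds carry open content in the kernel.
[cite: MoonenZarhin1999LowDim, Thm. 0.2 and §2 Thm. (2.7); arXiv:math/9901113] [cite: vanGeemen1994HodgeAV, Thm. 4.6] -/
theorem hcUpToDim_seven_iff_four_six_nonsimpleSeven
    (hTR : TankeevRibet1983_hodgeClasses_divisorial_powers_simplePrimeDimension)
    (h02 : MoonenZarhin1999_codimTwoHodgeClasses_abelianFivefold) :
    HCUpToDim 7 ↔ HCUpToDim 4 ∧ HCAtDim 6 ∧ HCOnClass fun A ↦ A.dim = 7 ∧ ¬ A.IsSimple := by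
  rw [hcUpToDim_seven_iff_of_tankeevRibet hTR, hcUpToDim_five_iff_hcUpToDim_four h02]

/-- **The same with row `4` replaced by its cell** (adds Moonen–Zarhin Thm. 0.1):
`HCUpToDim 7 ↔ WeilFourfolds ∧ HCAtDim 6 ∧ HC(non-simple sevenfolds)`.
[cite: MoonenZarhin1999LowDim, Thms. 0.1, 0.2, (2.7); arXiv:math/9901113] [cite: Markman2025SecantWeil, Cor. 1.6.1] -/
theorem hcUpToDim_seven_iff_weilFourfolds_six_nonsimpleSeven
    (hTR : TankeevRibet1983_hodgeClasses_divisorial_powers_simplePrimeDimension)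
    (h01 : MoonenZarhin1999_codimTwoHodgeClasses_abelianFourfold)
    (h02 : MoonenZarhin1999_codimTwoHodgeClasses_abelianFivefold) :
    HCUpToDim 7 ↔ Markman2025_weilClasses_algebraic_abelianFourfold ∧ HCAtDim 6 ∧
      HCOnClass fun A ↦ A.dim = 7 ∧ ¬ A.IsSimple := by
  rw [hcUpToDim_seven_iff_four_six_nonsimpleSeven hTR h02, hcUpToDim_four_iff_weilClassesFourfolds h01]

/-- **`HC_AV` on the atlas axis, modulo the three refereed classification facts**:
`HC_AV ↔ WeilFourfolds ∧ HCAtDim 6 ∧ HC(non-simple sevenfolds) ∧ HC(dim ≥ 8)` — the last conjunct being the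
residual `Theses.SevenfoldWeilCensus.HodgeAbelianDimGeEight` where no classification exists in print.
[cite: MoonenZarhin1999LowDim, Thms. 0.1, 0.2, (2.7); arXiv:math/9901113] -/
theorem hodgeAbelianVarieties_iff_atlas_of_classificationFacts
    (hTR : TankeevRibet1983_hodgeClasses_divisorial_powers_simplePrimeDimension)
    (h01 : MoonenZarhin1999_codimTwoHodgeClasses_abelianFourfold)
    (h02 : MoonenZarhin1999_codimTwoHodgeClasses_abelianFivefold) :
    Theses.PadicSemiregularLift.HodgeAbelianVarieties ↔
      Markman2025_weilClasses_algebraic_abelianFourfold ∧ HCAtDim 6 ∧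
        (HCOnClass fun A ↦ A.dim = 7 ∧ ¬ A.IsSimple) ∧ Theses.SevenfoldWeilCensus.HodgeAbelianDimGeEight := by
  rw [hodgeAbelianVarieties_iff_hcUpToDim_seven_and_dimGeEight,
    hcUpToDim_seven_iff_weilFourfolds_six_nonsimpleSeven hTR h01 h02, and_assoc, and_assoc]

/-! ## §R4 Under `HC_CM` (binder by name): what the conditional hypothesis changes on rows `g ≤ 7` -/

/-- **Item stmt-HodgeConjecture-16267 read on the atlas rows** (`HC_CM` a binder BY NAME): given `HC_CM`,
`CMToAbelian` yields `HC_AV` (landed `…CMPivot.hodgeAbelianVarieties_iff_cmAbelianHodge_and_cmToAbelian`), hence the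
four open conjuncts of §R3 — the Weil-fourfold cell, row `6`, the non-simple sevenfolds, `dim ≥ 8`. By §R1–§R2,
`HC_CM` is NOT load-bearing on rows `g ≤ 5` (they close from the refereed facts + the cell alone); where it is
load-bearing inside rows `6, 7` is the atlas's column (c7), not decided here. [cite: MoonenZarhin1999LowDim, Thms. 0.1, 0.2, (2.7)]
[cite: Milne1999, §7 (H)] -/
theorem atlasRows_of_cmToAbelian_of_hcCM (hCM : Theses.RankFourFaces.CMAbelianHodge)
    (h : Theses.RankFourFaces.CMToAbelian) :
    Markman2025_weilClasses_algebraic_abelianFourfold ∧ HCAtDim 6 ∧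
      (HCOnClass fun A ↦ A.dim = 7 ∧ ¬ A.IsSimple) ∧ Theses.SevenfoldWeilCensus.HodgeAbelianDimGeEight := by
  have hAV : Theses.PadicSemiregularLift.HodgeAbelianVarieties :=
    Theorems.HodgeAbelianVarieties.CMPivot.hodgeAbelianVarieties_iff_cmAbelianHodge_and_cmToAbelian.mpr ⟨hCM, h⟩
  exact ⟨weilClassesFourfolds_of_hodgeAbelianVarieties hAV, hcOnClass_of_hodgeAbelianVarieties _ hAV,
    hcOnClass_of_hodgeAbelianVarieties _ hAV, (hodgeAbelianVarieties_iff_hcUpToDim_seven_and_dimGeEight.mp hAV).2⟩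

/-- **Conversely, modulo the classification facts, the four conjuncts GIVE `CMToAbelian` outright** (they give
`HC_AV`; `HC_CM` is then not even used): on the atlas rows the conditional item and the unconditional target
differ only inside the CM cells. [cite: MoonenZarhin1999LowDim, Thms. 0.1, 0.2, (2.7)] -/
theorem cmToAbelian_of_atlas_of_classificationFacts
    (hTR : TankeevRibet1983_hodgeClasses_divisorial_powers_simplePrimeDimension)
    (h01 : MoonenZarhin1999_codimTwoHodgeClasses_abelianFourfold)
    (h02 : MoonenZarhin1999_codimTwoHodgeClasses_abelianFivefold)
    (hW : Markman2025_weilClasses_algebraic_abelianFourfold) (h6 : HCAtDim 6)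
    (h7 : HCOnClass fun A ↦ A.dim = 7 ∧ ¬ A.IsSimple) (h8 : Theses.SevenfoldWeilCensus.HodgeAbelianDimGeEight) :
    Theses.RankFourFaces.CMToAbelian :=
  fun _ A _ ↦ (hodgeAbelianVarieties_iff_atlas_of_classificationFacts hTR h01 h02).mpr ⟨hW, h6, h7, h8⟩ A

/-- Audit: every statement shape of this file is a consequence of `HodgeConjecture` (on-path).
[cite: Deligne2000, §1] -/
theorem rows_of_hodgeConjecture (h : _root_.HodgeConjecture) :
    Markman2025_weilClasses_algebraic_abelianFourfold ∧ HCUpToDim 4 ∧ HCUpToDim 5 ∧ HCAtDim 6 ∧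
      (HCOnClass fun A ↦ A.dim = 7 ∧ ¬ A.IsSimple) ∧ HCUpToDim 7 :=
  ⟨weilClassesFourfolds_of_hodgeAbelianVarieties (Ring2.Deform.HC_AV_of_hodgeConjecture h),
    hcOnClass_of_hodgeConjecture _ h, hcOnClass_of_hodgeConjecture _ h, hcOnClass_of_hodgeConjecture _ h,
    hcOnClass_of_hodgeConjecture _ h, hcOnClass_of_hodgeConjecture _ h⟩

end Summit.HodgeConjecture.HodgeConjecture.Ring2.ClassTargets

end
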